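import Literature.AlgebraicGeometry.Deligne1982.WeilTypeCMGeneralMemberHodgeRingUpToWeilDegree
import HarnessLib

/-!
# The Hodge ring of the general CM-Weil abelian variety below twice the Weil degree: `B^{j+k} = D^{j+k} + D^j ⌣ W_E` (`j < k`)

Deligne [Deligne1982HodgeCycles, §4 with Milne's 2003 re-edition endnote 16]: for a general polarized abelian variety
`(A, η, h)` of Weil type relative to the CM field `E = ℚ(η)` (`Hg(A) = SU(φ)`; `dim_E H¹(A, ℚ) = 2k`), «the `ℚ`-algebra of
Hodge cycles is generated by the divisor classes and the Weil classes» (tree: `Bᵖ ⊗ ℂ = DWᵖ` for every `p`,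
`IsWeilTypeCM.hodgeClassSpan_eq_divisorWeilAlgebra_of_hodgeGroupSU`). The Weil classes `W_E ⊆ H^{2k}(A, ℚ)` have degree
`2k`, so a product of two of them has degree `4k`: in the degrees `2(j + k)` with `j < k` the generated algebra is the
`D`-MODULE spanned by `1` and `W_E`, i.e. `DW^{j+k} = D^{j+k} ⊗ ℂ + (Dʲ ⊗ ℂ) ⌣ (W_E ⊗ ℂ)` — this file proves this for
every datum `(A, φ, P, k)` (no Weil-type hypothesis), by checking that the family `Dᵠ ⊗ ℂ + Σ_{j+k=q} Dʲ ⊗ ℂ ⌣ W_E ⊗ ℂ`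
(`q < 2k`), `H^{2q}` (`q ≥ 2k`) is a divisor–Weil family (closure under `⌣` is associativity and graded commutativity
of the cup product, Hatcher §3.2), and reads off the Hodge classes of the general member and of its `E`-isogeny class in
these degrees. For `E` imaginary quadratic (`e₀ = 1`, `dim A = 2k`) the extra summand vanishes in print («`Bᵖ = Dᵖ` for
`p ≠ n`», [vanGeemen1994HodgeAV, Thm. 6.12]: `D¹ ⌣ W_K = 0`); for `[E:ℚ] ≥ 4` it need not (`D'_γ ⌣ b_{top W_β} ≠ 0` for
`γ ≠ β`), which is why the statement is recorded as a sum.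

## What is proved (all `theorem`s; no definition, no named fact)

* §1 cup-product bookkeeping: `cupProduct_cupProduct_comm_right` (`(d ⌣ w) ⌣ d' = (d ⌣ d') ⌣ w` in even degrees).
* §2 for any `(A, φ, P, k)` and `j < k`: **`map₂_cupProduct_le_divisorWeilAlgebra`** (`Dʲ ⌣ W_E ⊆ DW^{j+k}`) and
  **`divisorWeilAlgebra_add_eq_sup_map₂`** (`DW^{j+k} = D^{j+k} ⊗ ℂ + Dʲ ⊗ ℂ ⌣ W_E ⊗ ℂ`).
* §3 the general member (`Hg(A) = SU(φ)`): **`IsWeilTypeCM.hodgeClassSpan_add_eq_of_hodgeGroupSU`**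
  (`B^{j+k} ⊗ ℂ = D^{j+k} ⊗ ℂ + Dʲ ⊗ ℂ ⌣ W_E ⊗ ℂ`, `j < k`), `IsWeilTypeCM.mem_sup_map₂_of_hodgeGroupSU` (class by class),
  `IsWeilTypeCM.hodgeClassSpan_eq_of_le_of_lt_two_mul_of_hodgeGroupSU` (`k ≤ p < 2k` form), and the `E`-isogeny class
  `hodgeClassSpan_add_eq_of_isIsogeny_of_hasHodgeGroupSUCM`.

## References

* [Deligne1982HodgeCycles] P. Deligne (notes by J. S. Milne), *Hodge cycles on abelian varieties*, LNM 900 (1982), §4;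
  Milne's 2003 re-edition, endnote 16 (p. 82).
* [vanGeemen1994HodgeAV] B. van Geemen, LNM 1594 (1994), 2.4 (the ring `D`), 6.7, Thm. 6.12 and its proof.
* [MoonenZarhin1998WeilClasses] B. Moonen, Yu. Zarhin, Crelle 496 (1998), §1 (the space `W_F ⊂ H^r(X, ℚ)`).
* [HatcherAT2002] A. Hatcher, *Algebraic Topology* (2002), §3.2: associativity (p. 211) and Thm. 3.11 (graded
  commutativity) of the cup product.
-/

noncomputable section

open CategoryTheory Polynomial Module
open Literature.AlgebraicTopology.SingularHomology
open Literature.AlgebraicGeometry.Motives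
open Literature.AlgebraicGeometry.HodgeTheory
open Literature.AlgebraicGeometry.VanGeemen1994
open Literature.AlgebraicGeometry.Milne1999
open Literature.Barriers.HodgeConjecture (divisorMonomials divisorClassesSpan mem_divisorMonomials_zero)

namespace Literature.AlgebraicGeometry.Deligne1982

/-! ### §1 Cup-product bookkeeping in even degrees -/

section Cup

variable {X : Motives.SchemeOver ℂ}

/-- **`(d ⌣ w) ⌣ d' = (d ⌣ d') ⌣ w` in even degrees**: associativity and graded commutativity (`w ⌣ d' = d' ⌣ w`, the
sign `(-1)^{2k·2r} = 1`). [cite: HatcherAT2002, §3.2 p. 211 and Thm. 3.11] -/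
theorem cupProduct_cupProduct_comm_right {j k r q s t : ℕ} (h₁ : 2 * j + 2 * k = 2 * q) (h₂ : 2 * q + 2 * r = 2 * s)
    (h₃ : 2 * j + 2 * r = 2 * t) (h₄ : 2 * t + 2 * k = 2 * s) (d : complexBetti X (2 * j))
    (w : complexBetti X (2 * k)) (d' : complexBetti X (2 * r)) :
    cupProduct h₂ (cupProduct h₁ d w) d' = cupProduct h₄ (cupProduct h₃ d d') w := by
  rw [cupProduct_assoc h₁ (show 2 * k + 2 * r = 2 * k + 2 * r from rfl) h₂ (by omega) d w d',
    cupProduct_gradedComm_holds ℂ (Motives.ComplexPoints X) (show 2 * k + 2 * r = 2 * k + 2 * r from rfl)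
      (show 2 * r + 2 * k = 2 * k + 2 * r by omega) w d']
  have hsign : ((-1 : ℂ) ^ (2 * k * (2 * r))) = 1 := by
    rw [show 2 * k * (2 * r) = 2 * (k * (2 * r)) by ring, pow_mul, neg_one_sq, one_pow]
  rw [hsign, one_smul,
    ← cupProduct_assoc h₃ (show 2 * r + 2 * k = 2 * k + 2 * r by omega) h₄ (show 2 * j + (2 * k + 2 * r) = 2 * s by omega) d d' w]

end Cup

/-! ### §2 The generated algebra in degrees `j + k`, `j < k` -/

section Structure

variable {A : AbelianVariety ℂ} {φ : A ⟶ A} {P : Polynomial ℤ} {k : ℕ}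

/-- **`Dʲ ⌣ W_E ⊆ DW^{j+k}`**: products of divisor monomials with Weil classes lie in the generated algebra (any `j`).
[cite: Deligne1982HodgeCycles, Milne 2003 re-edition endnote 16] -/
theorem map₂_cupProduct_le_divisorWeilAlgebra (j : ℕ) :
    Submodule.map₂ (cupProduct (two_mul_add_two_mul j k)) (divisorClassesSpan A.X A.dim j)
        (weilClassesField A φ P (2 * k)) ≤ divisorWeilAlgebra A φ P k (j + k) :=
  Submodule.map₂_le.2 fun _ hd _ hw =>
    (isDivisorWeilFamily_divisorWeilAlgebra A φ P k).cup_mem (divisorClassesSpan_le_divisorWeilAlgebra j hd)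
      (weilClassesField_le_divisorWeilAlgebra hw)

/-- **`DW^{j+k} = D^{j+k} ⊗ ℂ + Dʲ ⊗ ℂ ⌣ W_E ⊗ ℂ` for `j < k`**: below twice the Weil degree no product of two Weil classes
occurs, and the algebra generated by the divisor classes and `W_E` is the `D`-module spanned by `1` and `W_E` — the family
`Dᵠ + Σ_{i+k=q} Dⁱ ⌣ W_E` (`q < 2k`), `H^{2q}` (`q ≥ 2k`) is a divisor–Weil family (closure under `⌣`:
`d₁ ⌣ (d ⌣ w) = (d₁ ⌣ d) ⌣ w`, `(d ⌣ w) ⌣ d₂ = (d ⌣ d₂) ⌣ w`, and two module generators multiply into degree `≥ 2k`).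
[cite: Deligne1982HodgeCycles, Milne 2003 re-edition endnote 16] [cite: vanGeemen1994HodgeAV, 2.4 and Thm. 6.12]
[cite: HatcherAT2002, §3.2 p. 211 and Thm. 3.11] -/
theorem divisorWeilAlgebra_add_eq_sup_map₂ {j : ℕ} (hj : j < k) :
    divisorWeilAlgebra A φ P k (j + k) =
      divisorClassesSpan A.X A.dim (j + k) ⊔
        Submodule.map₂ (cupProduct (two_mul_add_two_mul j k)) (divisorClassesSpan A.X A.dim j)
          (weilClassesField A φ P (2 * k)) := by
  classical
  refine le_antisymm ?_ (sup_le (divisorClassesSpan_le_divisorWeilAlgebra (j + k)) (map₂_cupProduct_le_divisorWeilAlgebra j))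
  -- the `D`-module part in degree `q`: `Σ_{i + k = q} Dⁱ ⌣ W_E`
  let N : (q : ℕ) → Submodule ℂ (complexBetti A.X (2 * q)) := fun q =>
    ⨆ (i : ℕ) (hi : i + k = q), Submodule.map₂ (cupProduct ((two_mul_add_two_mul i k).trans (congrArg (2 * ·) hi)))
      (divisorClassesSpan A.X A.dim i) (weilClassesField A φ P (2 * k))
  let G : (q : ℕ) → Submodule ℂ (complexBetti A.X (2 * q)) := fun q =>
    if q < 2 * k then divisorClassesSpan A.X A.dim q ⊔ N q else ⊤
  -- generators of `N`
  have hNmem : ∀ (i q : ℕ) (hi : i + k = q) (h : 2 * i + 2 * k = 2 * q) {d : complexBetti A.X (2 * i)}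
      (_ : d ∈ divisorClassesSpan A.X A.dim i) {w : complexBetti A.X (2 * k)} (_ : w ∈ weilClassesField A φ P (2 * k)),
      cupProduct h d w ∈ N q := by
    intro i q hi h d hd w hw
    refine Submodule.mem_iSup_of_mem i (Submodule.mem_iSup_of_mem hi ?_)
    exact Submodule.apply_mem_map₂ _ hd hw
  -- `N q = 0` below the Weil degree
  have hNbot : ∀ q, q < k → N q = ⊥ := fun q hq =>
    iSup_eq_bot.2 fun i => iSup_eq_bot.2 fun hi => absurd hi (by omega)
  -- `D^q ⌣ N^r ⊆ N^{q+r}`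
  have hDN : ∀ (q r : ℕ) {d₁ : complexBetti A.X (2 * q)} (_ : d₁ ∈ divisorClassesSpan A.X A.dim q),
      N r ≤ (N (q + r)).comap (cupProduct (two_mul_add_two_mul q r) d₁) := by
    intro q r d₁ hd₁
    refine iSup₂_le fun i hi => Submodule.map₂_le.2 fun d hd w hw => ?_
    rw [Submodule.mem_comap,
      ← cupProduct_assoc (two_mul_add_two_mul q i) _ (show 2 * (q + i) + 2 * k = 2 * (q + r) by omega)]
    exact hNmem (q + i) (q + r) (by omega) _ (cupProduct_mem_divisorClassesSpan_of_mem rfl _ hd₁ hd) hw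
  -- `N^q ⌣ D^r ⊆ N^{q+r}`
  have hND : ∀ (q r : ℕ) {d₂ : complexBetti A.X (2 * r)} (_ : d₂ ∈ divisorClassesSpan A.X A.dim r),
      N q ≤ (N (q + r)).comap ((cupProduct (two_mul_add_two_mul q r)).flip d₂) := by
    intro q r d₂ hd₂
    refine iSup₂_le fun i hi => Submodule.map₂_le.2 fun d hd w hw => ?_
    rw [Submodule.mem_comap, LinearMap.flip_apply,
      cupProduct_cupProduct_comm_right _ _ (two_mul_add_two_mul i r) (show 2 * (i + r) + 2 * k = 2 * (q + r) by omega)]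
    exact hNmem (i + r) (q + r) (by omega) _ (cupProduct_mem_divisorClassesSpan_of_mem rfl _ hd hd₂) hw
  have hG : IsDivisorWeilFamily A φ P k G :=
    { one_mem := by
        change _ ∈ (if 0 < 2 * k then divisorClassesSpan A.X A.dim 0 ⊔ N 0 else ⊤)
        by_cases h0 : 0 < 2 * k
        · rw [if_pos h0]
          exact Submodule.mem_sup_left (Submodule.subset_span (mem_divisorMonomials_zero.2 rfl))
        · rw [if_neg h0]; exact Submodule.mem_top
      cup_mem := fun q r a b ha hb ↦ by
        change a ∈ (if q < 2 * k then divisorClassesSpan A.X A.dim q ⊔ N q else ⊤) at ha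
        change b ∈ (if r < 2 * k then divisorClassesSpan A.X A.dim r ⊔ N r else ⊤) at hb
        change _ ∈ (if q + r < 2 * k then divisorClassesSpan A.X A.dim (q + r) ⊔ N (q + r) else ⊤)
        by_cases hqr : q + r < 2 * k
        · rw [if_pos hqr]
          rw [if_pos (show q < 2 * k by omega)] at ha
          rw [if_pos (show r < 2 * k by omega)] at hb
          obtain ⟨d₁, hd₁, n₁, hn₁, rfl⟩ := Submodule.mem_sup.1 ha
          obtain ⟨d₂, hd₂, n₂, hn₂, rfl⟩ := Submodule.mem_sup.1 hb
          set T := divisorClassesSpan A.X A.dim (q + r) ⊔ N (q + r) with hT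
          have h₁ : cupProduct (two_mul_add_two_mul q r) d₁ d₂ ∈ T :=
            Submodule.mem_sup_left (cupProduct_mem_divisorClassesSpan_of_mem rfl _ hd₁ hd₂)
          have h₂ : cupProduct (two_mul_add_two_mul q r) d₁ n₂ ∈ T := Submodule.mem_sup_right (hDN q r hd₁ hn₂)
          have h₃ : cupProduct (two_mul_add_two_mul q r) n₁ d₂ ∈ T := by
            have := hND q r hd₂ hn₁
            rw [Submodule.mem_comap, LinearMap.flip_apply] at this
            exact Submodule.mem_sup_right this
          -- two module generators would multiply into degree `≥ 2k`: one of them is zero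
          have h₄ : cupProduct (two_mul_add_two_mul q r) n₁ n₂ ∈ T := by
            by_cases hq : k ≤ q
            · by_cases hr : k ≤ r
              · exfalso; omega
              · rw [hNbot r (by omega)] at hn₂
                rw [(Submodule.mem_bot ℂ).1 hn₂, map_zero]
                exact Submodule.zero_mem _
            · rw [hNbot q (by omega)] at hn₁
              rw [(Submodule.mem_bot ℂ).1 hn₁, map_zero, LinearMap.zero_apply]
              exact Submodule.zero_mem _
          have hsum : cupProduct (two_mul_add_two_mul q r) (d₁ + n₁) (d₂ + n₂) =
              cupProduct (two_mul_add_two_mul q r) d₁ d₂ + cupProduct (two_mul_add_two_mul q r) d₁ n₂ +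
                (cupProduct (two_mul_add_two_mul q r) n₁ d₂ + cupProduct (two_mul_add_two_mul q r) n₁ n₂) := by
            simp only [map_add, LinearMap.add_apply]
            abel
          rw [hsum]
          exact Submodule.add_mem _ (Submodule.add_mem _ h₁ h₂) (Submodule.add_mem _ h₃ h₄)
        · rw [if_neg hqr]
          exact Submodule.mem_top
      oneOne_mem := fun b hb hb' ↦ by
        change b ∈ (if 1 < 2 * k then divisorClassesSpan A.X A.dim 1 ⊔ N 1 else ⊤)
        by_cases h1 : 1 < 2 * k
        · rw [if_pos h1]
          exact Submodule.mem_sup_left (mem_divisorClassesSpan_one hb hb')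
        · rw [if_neg h1]; exact Submodule.mem_top
      weilClassesField_le := by
        change weilClassesField A φ P (2 * k) ≤ (if k < 2 * k then divisorClassesSpan A.X A.dim k ⊔ N k else ⊤)
        by_cases hk : k < 2 * k
        · rw [if_pos hk]
          intro w hw
          refine Submodule.mem_sup_right ?_
          have h1 : cupProduct (show 2 * 0 + 2 * k = 2 * k by omega)
              (singularCohomology.one ℂ (Motives.ComplexPoints A.X)) w = w := one_cupProduct w
          rw [← h1]
          exact hNmem 0 k (by omega) _ (Submodule.subset_span (mem_divisorMonomials_zero.2 rfl)) hw
        · rw [if_neg hk]; exact le_top }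
  have hle := divisorWeilAlgebra_le hG (j + k)
  change divisorWeilAlgebra A φ P k (j + k) ≤
    (if j + k < 2 * k then divisorClassesSpan A.X A.dim (j + k) ⊔ N (j + k) else ⊤) at hle
  rw [if_pos (by omega)] at hle
  refine hle.trans (sup_le le_sup_left (iSup₂_le fun i hi => ?_))
  obtain rfl : i = j := by omega
  exact le_sup_right

/-- The `k ≤ p < 2k` form: **`DWᵖ ⊆ Dᵖ ⊗ ℂ + D^{p-k} ⊗ ℂ ⌣ W_E ⊗ ℂ`** — every class of the generated algebra of degree
`2p`, `k ≤ p < 2k`, is a polynomial in divisor classes plus a sum of products (divisor monomial of degree `2(p-k)`) ⌣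
(Weil class). [cite: Deligne1982HodgeCycles, Milne 2003 re-edition endnote 16] [cite: vanGeemen1994HodgeAV, 2.4 and Thm. 6.12] -/
theorem mem_divisorWeilAlgebra_iff_of_le_of_lt {p : ℕ} (hkp : k ≤ p) (hp : p < 2 * k) {c : complexBetti A.X (2 * p)} :
    c ∈ divisorWeilAlgebra A φ P k p ↔
      ∃ d ∈ divisorClassesSpan A.X A.dim p, ∃ n ∈ ⨆ (i : ℕ) (hi : i + k = p),
        Submodule.map₂ (cupProduct ((two_mul_add_two_mul i k).trans (congrArg (2 * ·) hi)))
          (divisorClassesSpan A.X A.dim i) (weilClassesField A φ P (2 * k)), d + n = c := by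
  obtain ⟨j, rfl⟩ := Nat.exists_eq_add_of_le' hkp
  have hj : j < k := by omega
  rw [divisorWeilAlgebra_add_eq_sup_map₂ hj, Submodule.mem_sup]
  have hN : (⨆ (i : ℕ) (hi : i + k = j + k),
      Submodule.map₂ (cupProduct ((two_mul_add_two_mul i k).trans (congrArg (2 * ·) hi)))
        (divisorClassesSpan A.X A.dim i) (weilClassesField A φ P (2 * k))) =
      Submodule.map₂ (cupProduct (two_mul_add_two_mul j k)) (divisorClassesSpan A.X A.dim j)
        (weilClassesField A φ P (2 * k)) := by
    refine le_antisymm (iSup₂_le fun i hi => ?_) ?_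
    · obtain rfl : i = j := by omega
      exact le_rfl
    · exact le_iSup₂_of_le j rfl le_rfl
  rw [hN]

end Structure

/-! ### §3 The general member in degrees `j + k`, `j < k` -/

section GeneralMember

variable {A : AbelianVariety ℂ} {η : A ⟶ A} {R : Polynomial ℤ} {e₀ k : ℕ} {h : complexBetti A.X 2}

/-- **`B^{j+k} ⊗ ℂ = D^{j+k} ⊗ ℂ + Dʲ ⊗ ℂ ⌣ W_E ⊗ ℂ` for `j < k`** for the general CM-Weil abelian variety
(`Hg(A) = SU(φ)`): between the Weil degree and twice the Weil degree every Hodge class is a polynomial in divisor classes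
plus divisor monomials times Weil classes (endnote 16 as an equality, tree
`IsWeilTypeCM.hodgeClassSpan_eq_divisorWeilAlgebra_of_hodgeGroupSU`, and §2).
[cite: Deligne1982HodgeCycles, §4 and Milne 2003 re-edition endnote 16] [cite: vanGeemen1994HodgeAV, 6.7 and Thm. 6.12] -/
theorem IsWeilTypeCM.hodgeClassSpan_add_eq_of_hodgeGroupSU (hW : IsWeilTypeCM A η R e₀ k)
    (hpol : IsPolarizationClass A.dim A.X h) (hRos : IsRosatiCM A η h) (hSU : HasHodgeGroupSUCM A η (R.comp (X ^ 2)) h)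
    {j : ℕ} (hj : j < k) :
    hodgeClassSpan A.dim A.X (j + k) =
      divisorClassesSpan A.X A.dim (j + k) ⊔
        Submodule.map₂ (cupProduct (two_mul_add_two_mul j k)) (divisorClassesSpan A.X A.dim j)
          (weilClassesField A η (R.comp (X ^ 2)) (2 * k)) := by
  rw [hW.hodgeClassSpan_eq_divisorWeilAlgebra_of_hodgeGroupSU hpol hRos hSU (j + k), divisorWeilAlgebra_add_eq_sup_map₂ hj]

/-- Class by class: for the general CM-Weil member, **every rational `(j+k, j+k)`-class with `j < k` is the sum of an
element of `D^{j+k} ⊗ ℂ` and an element of `Dʲ ⊗ ℂ ⌣ W_E ⊗ ℂ`**. [cite: Deligne1982HodgeCycles, §4 and Milne 2003 re-edition endnote 16]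
[cite: vanGeemen1994HodgeAV, Thm. 6.12] -/
theorem IsWeilTypeCM.mem_sup_map₂_of_hodgeGroupSU (hW : IsWeilTypeCM A η R e₀ k)
    (hpol : IsPolarizationClass A.dim A.X h) (hRos : IsRosatiCM A η h) (hSU : HasHodgeGroupSUCM A η (R.comp (X ^ 2)) h)
    {j : ℕ} (hj : j < k) {c : complexBetti A.X (2 * (j + k))} (hc : IsRationalClass c)
    (hjk : IsOfHodgeType A.dim A.X (2 * (j + k)) (j + k) (j + k) c) :
    c ∈ divisorClassesSpan A.X A.dim (j + k) ⊔
        Submodule.map₂ (cupProduct (two_mul_add_two_mul j k)) (divisorClassesSpan A.X A.dim j)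
          (weilClassesField A η (R.comp (X ^ 2)) (2 * k)) := by
  rw [← hW.hodgeClassSpan_add_eq_of_hodgeGroupSU hpol hRos hSU hj]
  exact Submodule.subset_span ⟨hc, hjk⟩

/-- The `k ≤ p < 2k` form for the general member: **a rational `(p,p)`-class is `d + n` with `d ∈ Dᵖ ⊗ ℂ` and `n` in the
`D`-module generated by the Weil classes.** [cite: Deligne1982HodgeCycles, §4 and Milne 2003 re-edition endnote 16]
[cite: vanGeemen1994HodgeAV, Thm. 6.12] -/
theorem IsWeilTypeCM.exists_add_eq_of_le_of_lt_of_hodgeGroupSU (hW : IsWeilTypeCM A η R e₀ k)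
    (hpol : IsPolarizationClass A.dim A.X h) (hRos : IsRosatiCM A η h) (hSU : HasHodgeGroupSUCM A η (R.comp (X ^ 2)) h)
    {p : ℕ} (hkp : k ≤ p) (hp : p < 2 * k) {c : complexBetti A.X (2 * p)} (hc : IsRationalClass c)
    (hpp : IsOfHodgeType A.dim A.X (2 * p) p p c) :
    ∃ d ∈ divisorClassesSpan A.X A.dim p, ∃ n ∈ ⨆ (i : ℕ) (hi : i + k = p),
        Submodule.map₂ (cupProduct ((two_mul_add_two_mul i k).trans (congrArg (2 * ·) hi)))
          (divisorClassesSpan A.X A.dim i) (weilClassesField A η (R.comp (X ^ 2)) (2 * k)), d + n = c :=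
  (mem_divisorWeilAlgebra_iff_of_le_of_lt hkp hp).1
    (hW.hodgeClassSpan_le_divisorWeilAlgebra_of_hodgeGroupSU hpol hRos hSU p (Submodule.subset_span ⟨hc, hpp⟩))

variable {B : AbelianVariety ℂ} {f : A ⟶ B} {θ : B ⟶ B} {h' : complexBetti B.X 2}

/-- **On the `E`-isogeny class: `B^{j+k}(A) ⊗ ℂ = D^{j+k}(A) ⊗ ℂ + Dʲ(A) ⊗ ℂ ⌣ W_E(A) ⊗ ℂ`** (`j < k`) along an
`E`-equivariant isogeny `f : A ⟶ B` to a general CM-Weil `(B, θ, h')` (tree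
`hodgeClassSpan_eq_divisorWeilAlgebra_of_isIsogeny_of_hasHodgeGroupSUCM`, and §2 for the datum `(A, η)`).
[cite: Deligne1982HodgeCycles, Milne 2003 re-edition endnote 16] [cite: vanGeemen1994HodgeAV, 3.6 (p. 236) and Thm. 6.12] -/
theorem hodgeClassSpan_add_eq_of_isIsogeny_of_hasHodgeGroupSUCM (hW : IsWeilTypeCM B θ R e₀ k)
    (hpol : IsPolarizationClass B.dim B.X h') (hRos : IsRosatiCM B θ h') (hSU : HasHodgeGroupSUCM B θ (R.comp (X ^ 2)) h')
    (hf : AbelianVariety.IsIsogeny f) (hcomm : f ≫ θ = η ≫ f) {j : ℕ} (hj : j < k) :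
    hodgeClassSpan A.dim A.X (j + k) =
      divisorClassesSpan A.X A.dim (j + k) ⊔
        Submodule.map₂ (cupProduct (two_mul_add_two_mul j k)) (divisorClassesSpan A.X A.dim j)
          (weilClassesField A η (R.comp (X ^ 2)) (2 * k)) := by
  rw [hodgeClassSpan_eq_divisorWeilAlgebra_of_isIsogeny_of_hasHodgeGroupSUCM hW hpol hRos hSU hf hcomm (j + k),
    divisorWeilAlgebra_add_eq_sup_map₂ hj]

end GeneralMember

end Literature.AlgebraicGeometry.Deligne1982

end
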